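import Mathlib.Analysis.SpecialFunctions.Trigonometric.Bounds
import Literature.NumberTheory.LFunctions.RudnickSarnakPairRenormalise
import Literature.NumberTheory.LFunctions.RudnickSarnakUnrestrictedProofs
import HarnessLib

/-!
# Rudnick–Sarnak Theorem 3.2 for `ζ` at level `n = 2`, from Montgomery's theorem (proved)

Proofs only (no definitions, no named facts). Fifth and last instalment of the level-two case
of the named fact `Literature.NumberTheory.LFunctions.rudnick_sarnak_unrestricted` (Z. Rudnick,
P. Sarnak, *Zeros of principal `L`-functions and random matrix theory*, Duke Math. J. **81**
(1996), Theorem 3.2 for `m = 1`): the case `k = 1` of `RSUnrestrictedLimits`,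

  `rsUnrestrictedLimits_one : RH → ∀ Φ admissible on ℝ², C_2(f_Φ, T)/N(T) → ∫ Φ C_O`,

proved — as Rudnick–Sarnak indicate in the Remark after their Theorem 1.2 ("In the case of
`ζ(s)` and `n = 2`, Theorem 1.2 coincides with the result of Montgomery") — from the tree's
PROVED Montgomery theorem `montgomery_pair_correlation_restricted_holds`, through
`RudnickSarnakPairSmoothed.lean` (Montgomery integrated against a test function),
`RudnickSarnakPairCount.lean` (pairs at scale `1/log T`) and `RudnickSarnakPairRenormalise.lean`
(removal of the weight `w` and of the normalisation `Lγ/2π ↦ γ̃`, RS (3.71)–(3.77)). This file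
supplies the level-two bookkeeping and the assembly:

* `RudnickSarnak.rsPhiTest_one_eq_fourier` — `f_Φ(x) = ψ̂(x₁ − x₀)`, `ψ(a) = Φ(−a, a)` ((3.6));
* `RudnickSarnak.unrestrictedLevelSum_two` — `C_2` as a sum over ordered pairs of indices;
* `RudnickSarnak.norm_fourier_sub_fourier_le`, `RudnickSarnak.exists_decay_fourier` — `ψ̂` is
  Lipschitz and decays like `(1 + |y|)^{-6}` (Schwartz; Mathlib);
* `RudnickSarnak.rsPairingFunctional_two` — `∫ Φ C_O = Φ(0) + ∫ |v| Φ(v, −v) dv` ((3.9));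
* `rsUnrestrictedLimits_one` — the theorem;
* `rsUnrestrictedLimits_of_le_one` — levels `n = 1, 2` of `RSUnrestrictedLimits` in its own
  shape (with `rsUnrestrictedLimits_zero` of `RudnickSarnakUnrestrictedProofs.lean`); the levels
  `n ≥ 3` are RS §3 (Prop. 2.1, Lemmas 3.1–3.10) and remain the content of the named fact.

## References

* Z. Rudnick, P. Sarnak, Duke Math. J. 81 (1996): Thm. 1.2 and Remark, (3.2), (3.6), (3.9),
  Thm. 3.2, (3.71)–(3.77).
* H. L. Montgomery, Proc. Sympos. Pure Math. 24 (1973): Theorem.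
-/

noncomputable section

open Filter MeasureTheory Complex Finset Set
open scoped Real Topology FourierTransform ContDiff

namespace Literature.NumberTheory.LFunctions

namespace RudnickSarnak

/-! ## Level `n = 2`: the test function `f_Φ`, the pairing functional, and the assembly -/

/-- On `ℝ²` the hyperplane point with tail coordinate `η` is `(−η₀, η₀)`. [cite: RudnickSarnak1996, (3.6)] -/
theorem cons_neg_fin_one (η : Fin 1 → ℝ) :
    (Fin.cons (-η 0) η : Fin 2 → ℝ) = ![-(η 0), η 0] := by
  ext i
  fin_cases i
  · simp
  · simp only [Fin.mk_one, Matrix.cons_val_one, Matrix.cons_val_fin_one]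
    exact Fin.cons_succ _ _ 0

/-- **`f_Φ` at level two is a Fourier transform of the diagonal slice:**
`f_Φ(x) = ψ̂(x₁ − x₀)` with `ψ(a) = Φ(−a, a)` and `ψ̂ = 𝓕 ψ`. [cite: RudnickSarnak1996, (3.6)] -/
theorem rsPhiTest_one_eq_fourier (Φ : (Fin 2 → ℝ) → ℂ) (x : Fin 2 → ℝ) :
    rsPhiTest Φ x = 𝓕 (fun a : ℝ ↦ Φ ![-a, a]) (x 1 - x 0) := by
  unfold rsPhiTest
  rw [Real.fourier_real_eq_integral_exp_smul,
    ← (volume_preserving_funUnique (Fin 1) ℝ).integral_comp'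
      (fun v : ℝ ↦ cexp (↑(-2 * π * v * (x 1 - x 0)) * I) • Φ ![-v, v])]
  refine integral_congr_ae (Eventually.of_forall fun η ↦ ?_)
  simp only [MeasurableEquiv.funUnique_apply, Fin.default_eq_zero, Fin.sum_univ_one,
    Fin.succ_zero_eq_one, smul_eq_mul]
  rw [cons_neg_fin_one, mul_comm]
  congr 1
  congr 1
  push_cast
  ring

/-- The unrestricted level-two sum of a function of the difference is a sum over ordered pairs
of indices: `∑_{i : Fin 2 → Fin N} F(γ̃_{i 1} − γ̃_{i 0}) = ∑_{(a, b) < N} F(γ̃_a − γ̃_b)`.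
[cite: RudnickSarnak1996, (3.2)] -/
theorem unrestrictedLevelSum_two (F : ℝ → ℂ) (N : ℕ) :
    unrestrictedLevelSum 2 (fun x ↦ F (x 1 - x 0)) N =
      ∑ p ∈ Finset.range N ×ˢ Finset.range N,
        F (normalizedOrdinate p.1 - normalizedOrdinate p.2) := by
  unfold unrestrictedLevelSum
  rw [← ((finTwoArrowEquiv (Fin N)).symm.sum_comp _), Fintype.sum_prod_type,
    Finset.sum_product_right]
  simp only [finTwoArrowEquiv_symm_apply, Matrix.cons_val_one, Matrix.cons_val_fin_one,
    Matrix.cons_val_zero]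
  rw [← Fin.sum_univ_eq_sum_range]
  refine Finset.sum_congr rfl fun a _ ↦ ?_
  exact (Fin.sum_univ_eq_sum_range (fun b ↦ F (normalizedOrdinate b - normalizedOrdinate a)) N)

/-- **Lipschitz bound for `ψ̂`:** `‖ψ̂(y₁) − ψ̂(y₂)‖ ≤ 2π (∫ |v| ‖ψ(v)‖ dv) |y₁ − y₂|` for continuous
compactly supported `ψ` (`|e(−vy₁) − e(−vy₂)| ≤ 2π|v||y₁ − y₂|`). [folklore] -/
theorem norm_fourier_sub_fourier_le {ψ : ℝ → ℂ} (hψc : Continuous ψ) (hsupp : HasCompactSupport ψ)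
    (y₁ y₂ : ℝ) :
    ‖𝓕 ψ y₁ - 𝓕 ψ y₂‖ ≤ (2 * π * ∫ v, |v| * ‖ψ v‖) * |y₁ - y₂| := by
  have hvi : Integrable fun v : ℝ ↦ |v| * ‖ψ v‖ :=
    (continuous_abs.mul hψc.norm).integrable_of_hasCompactSupport hsupp.norm.mul_left
  have hint : ∀ y : ℝ, Integrable fun v : ℝ ↦ cexp (↑(-2 * π * v * y) * I) * ψ v := fun y ↦
    ((by fun_prop : Continuous fun v : ℝ ↦ cexp (↑(-2 * π * v * y) * I) * ψ v)).integrable_of_hasCompactSupport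
      hsupp.mul_left
  have e0 : 𝓕 ψ y₁ - 𝓕 ψ y₂ =
      ∫ v, (cexp (↑(-2 * π * v * y₁) * I) * ψ v - cexp (↑(-2 * π * v * y₂) * I) * ψ v) := by
    rw [Real.fourier_real_eq_integral_exp_smul, Real.fourier_real_eq_integral_exp_smul]
    simp_rw [smul_eq_mul]
    rw [integral_sub (hint y₁) (hint y₂)]
  have hbound : ∀ v : ℝ, ‖cexp (↑(-2 * π * v * y₁) * I) * ψ v - cexp (↑(-2 * π * v * y₂) * I) * ψ v‖ ≤
      2 * π * |y₁ - y₂| * (|v| * ‖ψ v‖) := by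
    intro v
    rw [← sub_mul, norm_mul]
    have hphase : ‖cexp (↑(-2 * π * v * y₁) * I) - cexp (↑(-2 * π * v * y₂) * I)‖ ≤
        2 * π * |y₁ - y₂| * |v| := by
      have e : cexp (↑(-2 * π * v * y₁) * I) - cexp (↑(-2 * π * v * y₂) * I) =
          cexp (↑(-2 * π * v * y₂) * I) * (cexp (I * ↑(-2 * π * v * (y₁ - y₂))) - 1) := by
        rw [mul_sub, mul_one, ← Complex.exp_add]
        congr 2
        push_cast
        ring
      rw [e, norm_mul, Complex.norm_exp_ofReal_mul_I, one_mul]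
      refine (Real.norm_exp_I_mul_ofReal_sub_one_le).trans (le_of_eq ?_)
      rw [Real.norm_eq_abs, abs_mul, abs_mul, abs_mul, abs_neg, abs_two, abs_of_pos Real.pi_pos]
      ring
    calc ‖cexp (↑(-2 * π * v * y₁) * I) - cexp (↑(-2 * π * v * y₂) * I)‖ * ‖ψ v‖
        ≤ 2 * π * |y₁ - y₂| * |v| * ‖ψ v‖ := mul_le_mul_of_nonneg_right hphase (norm_nonneg _)
      _ = 2 * π * |y₁ - y₂| * (|v| * ‖ψ v‖) := by ring
  rw [e0]
  calc ‖∫ v, (cexp (↑(-2 * π * v * y₁) * I) * ψ v - cexp (↑(-2 * π * v * y₂) * I) * ψ v)‖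
      ≤ ∫ v, 2 * π * |y₁ - y₂| * (|v| * ‖ψ v‖) :=
        norm_integral_le_of_norm_le (hvi.const_mul _) (Eventually.of_forall hbound)
    _ = (2 * π * ∫ v, |v| * ‖ψ v‖) * |y₁ - y₂| := by rw [integral_const_mul]; ring

/-- **Decay of `ψ̂`** for smooth compactly supported `ψ`: `ψ̂ = 𝓕 ψ` is a Schwartz function
(Mathlib: `HasCompactSupport.toSchwartzMap`, `SchwartzMap.fourier_coe`), whence
`‖ψ̂(y)‖ ≤ C (1 + |y|)^{-6}`. [folklore] -/
theorem exists_decay_fourier {ψ : ℝ → ℂ} (hψ : ContDiff ℝ ∞ ψ) (hsupp : HasCompactSupport ψ) :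
    ∃ C : ℝ, 0 ≤ C ∧ ∀ y, ‖𝓕 ψ y‖ ≤ C * ((1 + |y|) ^ 6)⁻¹ := by
  let S : SchwartzMap ℝ ℂ := hsupp.toSchwartzMap hψ
  let G : SchwartzMap ℝ ℂ := 𝓕 S
  have hGcoe : ∀ y, G y = 𝓕 ψ y := fun y ↦ by
    show (𝓕 S) y = 𝓕 ψ y
    rw [SchwartzMap.fourier_coe]
    rfl
  obtain ⟨C, hC⟩ : ∃ C : ℝ, ∀ y : ℝ, (1 + ‖y‖) ^ 6 * ‖iteratedFDeriv ℝ 0 G y‖ ≤ C :=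
    ⟨_, fun y ↦ SchwartzMap.one_add_le_sup_seminorm_apply (𝕜 := ℝ) (m := ((6 : ℕ), (0 : ℕ)))
      (k := 6) (n := 0) le_rfl le_rfl G y⟩
  have hC0 : 0 ≤ C := le_trans (by positivity) (hC 0)
  refine ⟨C, hC0, fun y ↦ ?_⟩
  have h := hC y
  rw [norm_iteratedFDeriv_zero, hGcoe, Real.norm_eq_abs] at h
  rw [← div_eq_mul_inv, le_div_iff₀ (by positivity), mul_comm]
  exact h

/-- Decay and Lipschitz constants for `ψ̂`, `ψ` smooth with compact support. [folklore] -/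
theorem exists_decay_lipschitz_fourier {ψ : ℝ → ℂ} (hψ : ContDiff ℝ ∞ ψ)
    (hsupp : HasCompactSupport ψ) :
    ∃ C_g K : ℝ, 0 ≤ C_g ∧ 0 ≤ K ∧ (∀ y, ‖𝓕 ψ y‖ ≤ C_g * ((1 + |y|) ^ 6)⁻¹) ∧
      ∀ y₁ y₂, ‖𝓕 ψ y₁ - 𝓕 ψ y₂‖ ≤ K * |y₁ - y₂| := by
  obtain ⟨C, hC0, hC⟩ := exists_decay_fourier hψ hsupp
  have hI : 0 ≤ ∫ v, |v| * ‖ψ v‖ := integral_nonneg fun v ↦ by positivity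
  exact ⟨C, 2 * π * ∫ v, |v| * ‖ψ v‖, hC0, by positivity, hC,
    norm_fourier_sub_fourier_le hψ.continuous hsupp⟩

open scoped Classical in
/-- The partial matchings of `{0, 1}`: the empty one and `{(0, 1)}`. [cite: RudnickSarnak1996, (3.9)] -/
theorem filter_isPartialMatching_two :
    (Finset.univ : Finset (Finset (Fin 2 × Fin 2))).filter IsPartialMatching =
      {∅, {((0 : Fin 2), (1 : Fin 2))}} := by
  ext M
  simp only [Finset.mem_filter, Finset.mem_univ, true_and, Finset.mem_insert, Finset.mem_singleton]
  constructor
  · intro hM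
    have hsub : M ⊆ {((0 : Fin 2), (1 : Fin 2))} := by
      intro p hp
      have hlt := hM.1 p hp
      rw [Finset.mem_singleton]
      ext
      · fin_cases p <;> simp_all
      · fin_cases p <;> simp_all
    rcases Finset.subset_singleton_iff.1 hsub with h | h
    · exact Or.inl h
    · exact Or.inr h
  · rintro (rfl | rfl)
    · exact ⟨by simp, by simp [Set.PairwiseDisjoint]⟩
    · refine ⟨by simp, ?_⟩
      simp [Set.PairwiseDisjoint, Set.Pairwise]

/-- `e_{0,1} = e₀ − e₁ = (1, −1)` in `ℝ²`. [cite: RudnickSarnak1996, (3.10)] -/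
theorem rsBasisDiff_zero_one : rsBasisDiff (((0 : Fin 2), (1 : Fin 2))) = ![1, -1] := by
  ext i
  fin_cases i <;> simp [rsBasisDiff]

open scoped Classical in
/-- **The pairing functional at level two:** `∫ Φ C_O = Φ(0) + ∫ |v| Φ(v, −v) dv`
((3.9) with the single pair `{0, 1}`). [cite: RudnickSarnak1996, (3.9)] -/
theorem rsPairingFunctional_two (Φ : (Fin 2 → ℝ) → ℂ) :
    rsPairingFunctional 2 Φ = Φ 0 + ∫ v : ℝ, ((|v| : ℝ) : ℂ) * Φ ![v, -v] := by
  unfold rsPairingFunctional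
  rw [filter_isPartialMatching_two, Finset.sum_pair (by simp)]
  rw [integral_emptyMatching_eq]
  congr 1
  -- the one-pair term: an integral over the one-point index type
  set M₀ : Finset (Fin 2 × Fin 2) := {((0 : Fin 2), (1 : Fin 2))} with hM₀
  haveI : Unique (M₀ : Type) :=
    ⟨⟨⟨((0 : Fin 2), (1 : Fin 2)), by simp [hM₀]⟩⟩, fun x ↦ Subtype.ext (by
      have := x.2; simp only [hM₀, Finset.mem_singleton] at this; exact this)⟩
  have hdef : ((default : (M₀ : Type)) : Fin 2 × Fin 2) = ((0 : Fin 2), (1 : Fin 2)) := by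
    have h2 := (default : (M₀ : Type)).2
    simp only [hM₀, Finset.mem_singleton] at h2
    exact h2
  -- the two `volume`s on `M₀ → ℝ` carry different `Fintype` instances; `convert` bridges them
  convert ((volume_preserving_funUnique (M₀ : Type) ℝ).integral_comp'
    (fun a : ℝ ↦ ((|a| : ℝ) : ℂ) * Φ ![a, -a])) using 3
  · congr 1
    exact Subsingleton.elim _ _
  · congr 1
    exact Subsingleton.elim _ _
  · simp only [MeasurableEquiv.funUnique_apply, Fintype.prod_unique, Fintype.sum_unique, hdef,
      rsBasisDiff_zero_one]
    congr 2
    ext i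
    fin_cases i <;> simp

end RudnickSarnak

/-- **Rudnick–Sarnak, Theorem 3.2 for `ζ` at level `n = 2`** (the case `k = 1` of
`RSUnrestrictedLimits`), proved from Montgomery's pair correlation theorem as Rudnick–Sarnak
indicate (Duke Math. J. 81 (1996), Remark after Thm. 1.2: "In the case of `ζ(s)` and `n = 2`,
Theorem 1.2 coincides with the result of Montgomery"): assuming RH, for every admissible `Φ` on
`ℝ²`, `C_2(f_Φ, T)/N(T) → ∫ Φ C_O = Φ(0) + ∫ |v| Φ(v, −v) dv`. Proof: `f_Φ(x) = ψ̂(x₁ − x₀)`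
with `ψ(a) = Φ(−a, a)` supported in `|a| < 1 − δ/2` (`RudnickSarnak.rsPhiTest_one_eq_fourier`);
Montgomery's theorem integrated against `ψ` gives
`(1/N(T)) ∑ w(γ − γ') ψ̂(L(γ − γ')/2π) → ψ(0) + ∫ |α| ψ(α) dα`
(`RudnickSarnak.tendsto_sum_pairs_weight_fourier_div`); the weight and the normalisation are
removed by `RudnickSarnak.eventually_sum_norm_sub_weight_mul_le` (RS (3.71)–(3.77)); and
`ψ(0) + ∫ |α| ψ(α) dα = ∫ Φ C_O` (`RudnickSarnak.rsPairingFunctional_two`).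
[cite: RudnickSarnak1996, Thm 3.2] -/
theorem rsUnrestrictedLimits_one (hRH : RiemannHypothesis) {Φ : (Fin 2 → ℝ) → ℂ}
    (hΦ : IsRSAdmissiblePhi 1 Φ) :
    Tendsto (fun T : ℝ ↦ unrestrictedLevelSum 2 (rsPhiTest Φ) (zetaZeroCount T) /
      zetaZeroCount T) atTop (𝓝 (rsPairingFunctional 2 Φ)) := by
  -- the slice `ψ(a) = Φ(−a, a)` and its transform `g = ψ̂`
  set ψ : ℝ → ℂ := fun a ↦ Φ ![-a, a] with hψdef
  have hv : (fun a : ℝ ↦ (![-a, a] : Fin 2 → ℝ)) = fun a ↦ a • ![-1, 1] := by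
    funext a
    ext i
    fin_cases i <;> simp
  have hψd : ContDiff ℝ ∞ ψ := by
    have : ψ = Φ ∘ fun a : ℝ ↦ a • (![-1, 1] : Fin 2 → ℝ) := by
      rw [hψdef, ← hv]
      rfl
    rw [this]
    exact hΦ.contDiff.comp (contDiff_id.smul contDiff_const)
  obtain ⟨δ, hδ, hΦ0⟩ := hΦ.support_subset
  have hψ0 : ∀ α : ℝ, 1 - δ / 2 < |α| → ψ α = 0 := by
    intro α hα
    show Φ ![-α, α] = 0
    refine hΦ0 _ ?_
    simp [Fin.sum_univ_succ, abs_neg]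
    linarith
  have hψs : HasCompactSupport ψ := RudnickSarnak.hasCompactSupport_of_eq_zero hψ0
  have hψc : Continuous ψ := hψd.continuous
  obtain ⟨C_g, K, hCg, hK, hdec, hlip⟩ := RudnickSarnak.exists_decay_lipschitz_fourier hψd hψs
  set g : ℝ → ℂ := 𝓕 ψ with hgdef
  -- rewrite the level-two sums and the limit
  have hf : rsPhiTest Φ = fun x ↦ g (x 1 - x 0) := by
    funext x
    exact RudnickSarnak.rsPhiTest_one_eq_fourier Φ x
  have hsum : ∀ T : ℝ, unrestrictedLevelSum 2 (rsPhiTest Φ) (zetaZeroCount T) =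
      ∑ p ∈ zeroIndexSet T ×ˢ zeroIndexSet T,
        g (normalizedOrdinate p.1 - normalizedOrdinate p.2) := by
    intro T
    rw [hf, RudnickSarnak.unrestrictedLevelSum_two]
    rfl
  have hlim : rsPairingFunctional 2 Φ = ψ 0 + ∫ α, ((|α| : ℝ) : ℂ) * ψ α := by
    rw [RudnickSarnak.rsPairingFunctional_two]
    have h0 : Φ 0 = ψ 0 := by
      simp only [hψdef, neg_zero]
      congr 1
      ext i
      fin_cases i <;> simp
    rw [h0]
    congr 1
    rw [← integral_neg_eq_self]
    refine integral_congr_ae (Eventually.of_forall fun v ↦ ?_)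
    simp [hψdef, abs_neg]
  simp_rw [hsum]
  rw [hlim]
  -- Montgomery's side and the error
  have hB := RudnickSarnak.tendsto_sum_pairs_weight_fourier_div hRH hψc (δ := δ / 2)
    (by positivity) hψ0
  have hdiff : Tendsto (fun T : ℝ ↦
      (∑ p ∈ zeroIndexSet T ×ˢ zeroIndexSet T, g (normalizedOrdinate p.1 - normalizedOrdinate p.2)) /
          zetaZeroCount T -
        (∑ p ∈ zeroIndexSet T ×ˢ zeroIndexSet T,
          (montgomeryWeight (zetaOrdinate p.1 - zetaOrdinate p.2) : ℂ) *
            𝓕 ψ (Real.log T / (2 * π) * (zetaOrdinate p.1 - zetaOrdinate p.2))) /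
          zetaZeroCount T) atTop (𝓝 0) := by
    refine Metric.tendsto_nhds.2 fun ε hε ↦ ?_
    filter_upwards [RudnickSarnak.eventually_sum_norm_sub_weight_mul_le hRH hCg hK hdec hlip
      (half_pos hε), tendsto_zetaZeroCount_atTop_holds.eventually_ge_atTop 1] with T hT hN
    have hNpos : (0 : ℝ) < zetaZeroCount T := by exact_mod_cast hN
    rw [dist_zero_right, ← sub_div, ← Finset.sum_sub_distrib, norm_div, Complex.norm_natCast,
      div_lt_iff₀ hNpos]
    calc ‖∑ p ∈ zeroIndexSet T ×ˢ zeroIndexSet T,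
          (g (normalizedOrdinate p.1 - normalizedOrdinate p.2) -
            (montgomeryWeight (zetaOrdinate p.1 - zetaOrdinate p.2) : ℂ) *
              𝓕 ψ (Real.log T / (2 * π) * (zetaOrdinate p.1 - zetaOrdinate p.2)))‖
        ≤ ∑ p ∈ zeroIndexSet T ×ˢ zeroIndexSet T,
          ‖g (normalizedOrdinate p.1 - normalizedOrdinate p.2) -
            (montgomeryWeight (zetaOrdinate p.1 - zetaOrdinate p.2) : ℂ) *
              𝓕 ψ (Real.log T / (2 * π) * (zetaOrdinate p.1 - zetaOrdinate p.2))‖ :=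
          norm_sum_le _ _
      _ ≤ ε / 2 * zetaZeroCount T := hT
      _ < ε * zetaZeroCount T := by nlinarith
  have h := hdiff.add hB
  rw [zero_add] at h
  exact h.congr fun T ↦ by ring

/-- **Levels `n = 1, 2` of `RSUnrestrictedLimits`** (RS Theorem 3.2 for `ζ`), in the exact
shape of that `Prop` restricted to `k ≤ 1`: level one is `rsUnrestrictedLimits_zero`
(unconditional), level two is `rsUnrestrictedLimits_one` (under RH, from Montgomery's theorem).
[cite: RudnickSarnak1996, Thm 3.2] -/
theorem rsUnrestrictedLimits_of_le_one (hRH : RiemannHypothesis) {k : ℕ} (hk : k ≤ 1)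
    {Φ : (Fin (k + 1) → ℝ) → ℂ} (hΦ : IsRSAdmissiblePhi k Φ) :
    Tendsto (fun T : ℝ ↦ unrestrictedLevelSum (k + 1) (rsPhiTest Φ) (zetaZeroCount T) /
      zetaZeroCount T) atTop (𝓝 (rsPairingFunctional (k + 1) Φ)) := by
  interval_cases k
  · exact rsUnrestrictedLimits_zero Φ
  · exact rsUnrestrictedLimits_one hRH hΦ

end Literature.NumberTheory.LFunctions

end
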